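import Literature.Computability.Complexity.IntMatrixBricks
import HarnessLib

/-!
# Integer matrix bricks in the `FP` algebra, II: outer-product accumulation `∑ⱼ uⱼ uⱼᵀ` into an `n²`-queue

Toolkit continuing `IntMatrixBricks.lean`. The Gram-type matrices of the integer coNP certificates
for `GapCVP` (`AᵀA = ∑ⱼ aⱼ aⱼᵀ`, `RᵀR`, `S Sᵀ = ∑ⱼ uⱼ uⱼᵀ` — `Algebra/EuclideanLattices/
GapCVPCoNPWitness.lean`, `ARVerifier.lean`) are sums of OUTER PRODUCTS of the rows of a list; a
machine streams the rows, so the product is accumulated into a flat row-major `n × n` accumulator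
held as ONE rotating queue of `n²` difference pairs (the discipline of `rowLoopFn`): processing
row `uⱼ` means `n` calls of the row loop, the `i`-th of which pops the `n` entries of block `i`
from the front, adds `uⱼ[i] · uⱼ[k]` to the `k`-th, and appends them at the back — after the `n`
calls the queue is back in order with `uⱼ uⱼᵀ` added.

* `rowLoopDPFn_spec'` — the row loop on a queue LONGER than `n` (it updates the front block);
* `midLoopFn` — one vector: `n` row-loop calls with multipliers `u[0], …, u[n-1]` read by index
  (`midLoopFn_spec`, model `outerBlocks`, closed form `outerBlocks_eq` / values `ival_outerNew`);
* `outLoopFn p` — all vectors `rows[0], …, rows[J-1]` for a binary count `J ≤ p(|x|)`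
  (`outLoopFn_spec`, model `outerAcc`, values `ival_outerAcc`). Each row is read PADDED by a
  caller-supplied ruler `u` (`rows[j] ++ u`, `|u| ≥ n`), so that the inner loops always get their `n`
  rounds and the queue stays aligned whatever the witness string is; on well-formed rows of `n`
  entries the padding is never read (`elemOf_body_append_of_lt`).

Growth: the middle round runs a row loop (polynomial growth in the fixed field), the outer round a
middle loop (again polynomial) — `loopFn_mem_FP_of_poly` twice.

## References

* S. Arora, B. Barak, *Computational Complexity: A Modern Approach*, CUP 2009, §1.3.
* D. E. Knuth, *The Art of Computer Programming*, Vol. 2, 3rd ed., 1998, §4.6.4.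
-/

namespace Literature.Computability.Complexity

open _root_.Computability OracleCompose PRelSigPi Polynomial

namespace Brick

/-! ### Reading a list code followed by padding -/

/-- In-range access ignores anything appended after a list code. [folklore] -/
theorem elemOf_body_append_of_lt (l : List (List Bool)) (t : List Bool) {i : ℕ} (h : i < l.length) :
    elemOf (body l ++ t) i = l[i] := by
  induction l generalizing i with
  | nil => simp at h
  | cons a l ih =>
    cases i with
    | zero => rw [elemOf_zero, fstP_body_cons_append]; rfl
    | succ i =>
      rw [elemOf_succ, sndP_body_cons_append]
      exact ih (by simpa using h)

/-! ### The row loop on a longer queue -/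

/-- **The row loop updates the front block of a longer queue**: from
`⟨⟨ents, c⟩, ⟨n, ⟨1ᵏ, body acc⟩⟩⟩` with `n ≤ |acc|` and `n ≤ |⟨ents, c⟩|`, the loop ends with index
`1ᵏ⁺ⁿ` and the queue `acc.drop n ++ news` (the updated front block moved to the back).
[cite: KnuthTAOCP2, §4.6.4] -/
theorem rowLoopDPFn_spec' (ents c : List Bool) (n k : ℕ) (acc : List (List Bool)) (hnacc : n ≤ acc.length)
    (hn : n ≤ (boolPair ents c).length) :
    rowLoopDPFn (boolPair (boolPair ents c) (boolPair (encodeNat n) (boolPair (List.replicate k true) (body acc)))) =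
      boolPair (boolPair ents c) (boolPair []
        (boolPair (List.replicate (k + n) true) (body (acc.drop n ++ rowNewsDP ents c k acc n)))) := by
  rw [rowLoopDPFn, show fstF (boolPair (boolPair ents c) (boolPair (encodeNat n)
      (boolPair (List.replicate k true) (body acc)))) = boolPair ents c by simp [fstF], eval_X,
    iterate_loopStep rowBodyDP _ n _ _ hn,
    loopModel_eq_iterate (g := rowStepDP ents c) (fun cnt s => rowBodyDP_apply ents c cnt s),
    iterate_rowStepDP ents c k acc n hnacc]

/-! ### Middle level: one vector's outer product added to the `n²`-queue -/

/-- The record of the middle loop is `⟨⟨row, nc⟩, ⟨cnt, ⟨iu, q⟩⟩⟩`; the record handed to the row loop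
is `⟨⟨row, row[|iu|]⟩, ⟨nc, ⟨1⁰, q⟩⟩⟩`. [cite: KnuthTAOCP2, §4.6.4] -/
noncomputable def midSetupFn : List Bool → List Bool :=
  fanoutFn (fanoutFn (fstF ∘ nthF 0) (elemFn ∘ fanoutFn (nthF 2) (fstF ∘ nthF 0)))
    (fanoutFn (sndF ∘ nthF 0) (fanoutFn (fun _ => []) (sndPow 2)))

/-- `midSetupFn ∈ FP`. [cite: AroraBarakCC2009, §1.3] -/
theorem midSetupFn_mem_FP : midSetupFn ∈ FP :=
  fanoutFn_mem_FP (fanoutFn_mem_FP (comp_mem_FP fstF_mem_FP (nthF_mem_FP 0))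
      (comp_mem_FP elemFn_mem_FP (fanoutFn_mem_FP (nthF_mem_FP 2) (comp_mem_FP fstF_mem_FP (nthF_mem_FP 0)))))
    (fanoutFn_mem_FP (comp_mem_FP sndF_mem_FP (nthF_mem_FP 0)) (fanoutFn_mem_FP (const_mem_FP _) (sndPow_mem_FP 2)))

/-- **The middle round**: `⟨iu, q⟩ ↦ ⟨1 · iu, queue after the row loop with multiplier row[|iu|]⟩`.
[cite: KnuthTAOCP2, §4.6.4] -/
noncomputable def midBody : List Bool → List Bool :=
  fanoutFn (List.cons true ∘ nthF 2) (sndPow 2 ∘ rowLoopDPFn ∘ midSetupFn)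

/-- `midBody ∈ FP`. [cite: AroraBarakCC2009, §1.3] -/
theorem midBody_mem_FP : midBody ∈ FP :=
  fanoutFn_mem_FP (comp_mem_FP (cons_mem_FP true) (nthF_mem_FP 2))
    (comp_mem_FP (sndPow_mem_FP 2) (comp_mem_FP rowLoopDPFn_mem_FP midSetupFn_mem_FP))

/-- The state map of the middle loop. [folklore] -/
noncomputable def midStep (row nc : List Bool) (s : List Bool) : List Bool :=
  boolPair (true :: fstP s)
    (sndPow 2 (rowLoopDPFn (boolPair (boolPair row (elemOf row (fstP s).length)) (boolPair nc (boolPair [] (sndP s))))))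

/-- The middle round on a record is the state map. [folklore] -/
theorem midBody_apply (row nc cnt s : List Bool) :
    midBody (boolPair (boolPair row nc) (boolPair cnt s)) = midStep row nc s := by
  have h1 : midSetupFn (boolPair (boolPair row nc) (boolPair cnt s)) =
      boolPair (boolPair row (elemOf row (fstP s).length)) (boolPair nc (boolPair [] (sndP s))) := by
    simp only [midSetupFn, fanoutFn_apply, Function.comp_apply, elemFn_boolPair]
    simp [nthF, sndPow, fstF, sndF, fstP, sndP]
  have h2 : nthF 2 (boolPair (boolPair row nc) (boolPair cnt s)) = fstP s := by simp [nthF, fstF, sndF, fstP]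
  unfold midBody midStep
  rw [fanoutFn_apply]
  rw [Function.comp_apply, Function.comp_apply, Function.comp_apply]
  rw [h2]
  rw [h1]

/-- Deeper tails are shorter: `|sndPow 2 r| ≤ |sndPow 1 r|`. [folklore] -/
theorem length_sndPow_two_le (r : List Bool) : (sndPow 2 r).length ≤ (sndPow 1 r).length := by
  have h1 := length_fstF_sndF_le (sndPow 1 r)
  simp only [sndPow, Function.comp_apply] at h1 ⊢
  omega

/-- **Growth of a middle round is polynomial in the fixed field, on every record.** [folklore] -/
theorem length_midBody_le (z : List Bool) :
    (midBody z).length ≤ (sndPow 1 z).length + (2 * X + 10 + 126 * (X + 1) * (3 * X + 3)).eval (fstF z).length := by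
  have hiu : nthF 2 z = fstF (sndPow 1 z) := by simp [nthF, sndPow, fstF, sndF]
  have ht : sndPow 2 z = sndF (sndPow 1 z) := by simp [sndPow]
  have hst := length_fstF_sndF_le (sndPow 1 z)
  have hxsplit := length_fstF_sndF_le (fstF z)
  have hc : (elemOf (fstF (fstF z)) (fstF (sndPow 1 z)).length).length ≤ (fstF (fstF z)).length := length_elemOf_le _ _
  have hsetup : midSetupFn z = boolPair (boolPair (fstF (fstF z)) (elemOf (fstF (fstF z)) (fstF (sndPow 1 z)).length))
      (boolPair (sndF (fstF z)) (boolPair [] (sndF (sndPow 1 z)))) := by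
    simp only [midSetupFn, fanoutFn_apply, Function.comp_apply, elemFn_boolPair, hiu, ht]
    rfl
  set xin := boolPair (fstF (fstF z)) (elemOf (fstF (fstF z)) (fstF (sndPow 1 z)).length) with hxin
  set zin := boolPair xin (boolPair (sndF (fstF z)) (boolPair [] (sndF (sndPow 1 z)))) with hzin
  have hxinlen : xin.length ≤ 3 * (fstF z).length + 2 := by rw [hxin, length_boolPair]; omega
  have hzinlen : zin.length = 2 * xin.length + 2 + (2 * (sndF (fstF z)).length + 2 + (2 * 0 + 2 + (sndF (sndPow 1 z)).length)) := by
    simp only [hzin, length_boolPair, List.length_nil]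
  have hfz : fstF zin = xin := by simp [hzin, fstF]
  have hrow : rowLoopDPFn zin = (loopStep rowBodyDP)^[xin.length] zin := by rw [rowLoopDPFn, hfz, eval_X]
  have hrlen := length_iterate_loopStep_rowBodyDP_le xin.length zin
  rw [hfz] at hrlen
  have hrfst : fstF ((loopStep rowBodyDP)^[xin.length] zin) = xin := by rw [fstF_iterate_loopStep, hfz]
  have hrstruct := length_sndPow_one_add_le ((loopStep rowBodyDP)^[xin.length] zin)
  rw [hrfst] at hrstruct
  have h3 := length_sndPow_two_le ((loopStep rowBodyDP)^[xin.length] zin)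
  have hbody : midBody z = boolPair (true :: fstF (sndPow 1 z)) (sndPow 2 ((loopStep rowBodyDP)^[xin.length] zin)) := by
    simp only [midBody, fanoutFn_apply, Function.comp_apply, hsetup, hrow, hiu]
  rw [hbody, length_boolPair, List.length_cons]
  simp only [eval_add, eval_mul, eval_ofNat, eval_X, eval_one]
  have key : (sndPow 2 ((loopStep rowBodyDP)^[xin.length] zin)).length ≤
      (sndF (sndPow 1 z)).length + 2 * (sndF (fstF z)).length + 6 + xin.length * (42 * (xin.length + 1)) := by
    omega
  have hm2 : xin.length * (42 * (xin.length + 1)) ≤ (3 * (fstF z).length + 2) * (42 * (3 * (fstF z).length + 3)) :=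
    Nat.mul_le_mul hxinlen (Nat.mul_le_mul_left 42 (by omega))
  nlinarith [key, hm2, hst, hxsplit]

/-- **The middle loop**: `|⟨row, nc⟩|` rounds. [cite: KnuthTAOCP2, §4.6.4] -/
noncomputable def midLoopFn (z : List Bool) : List Bool := (loopStep midBody)^[X.eval (fstF z).length] z

/-- `midLoopFn ∈ FP`. [cite: AroraBarakCC2009, §1.3] -/
theorem midLoopFn_mem_FP : midLoopFn ∈ FP :=
  loopFn_mem_FP_of_poly midBody_mem_FP (2 * X + 10 + 126 * (X + 1) * (3 * X + 3)) length_midBody_le X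

/-- The queue after `i` middle rounds: round `i` updates the front block with multiplier `row[i]`
and moves it to the back. [folklore] -/
noncomputable def outerBlocks (row : List Bool) (acc : List (List Bool)) (n : ℕ) : ℕ → List (List Bool)
  | 0 => acc
  | i + 1 => (outerBlocks row acc n i).drop n ++ rowNewsDP row (elemOf row i) 0 (outerBlocks row acc n i) n

/-- The queue keeps its length `≥ n`. [folklore] -/
theorem length_outerBlocks (row : List Bool) {acc : List (List Bool)} {n : ℕ} (h : n ≤ acc.length) :
    ∀ i, (outerBlocks row acc n i).length = acc.length
  | 0 => rfl
  | i + 1 => by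
    rw [outerBlocks, List.length_append, List.length_drop, length_outerBlocks row h i, length_rowNewsDP]
    omega

/-- The middle invariant. [folklore] -/
theorem iterate_midStep (row nc : List Bool) {acc : List (List Bool)} {n : ℕ} (hacc : n ≤ acc.length)
    (hnc : nc = encodeNat n) (hn : n ≤ 2 * row.length + 2) :
    ∀ i : ℕ, (midStep row nc)^[i] (boolPair [] (body acc)) = boolPair (List.replicate i true) (body (outerBlocks row acc n i))
  | 0 => rfl
  | i + 1 => by
    rw [Function.iterate_succ_apply', iterate_midStep row nc hacc hnc hn i, midStep, fstP_boolPair, sndP_boolPair,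
      List.length_replicate, hnc]
    have hlen : n ≤ (outerBlocks row acc n i).length := by rw [length_outerBlocks row hacc i]; exact hacc
    have hrounds : n ≤ (boolPair row (elemOf row i)).length := by rw [length_boolPair]; omega
    have hspec := rowLoopDPFn_spec' row (elemOf row i) n 0 (outerBlocks row acc n i) hlen hrounds
    rw [List.replicate_zero] at hspec
    rw [hspec]
    have hproj : ∀ A B C : List Bool, sndPow 2 (boolPair A (boolPair [] (boolPair B C))) = C := fun A B C => by simp [sndPow, sndF]
    rw [hproj, List.replicate_succ]
    rfl

/-- **Specification of the middle loop**: from `⟨⟨row, n⟩, ⟨n, ⟨1⁰, body acc⟩⟩⟩` with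
`n ≤ |acc|` and `n ≤ 2|row| + 2`, the loop ends with index `1ⁿ` and the queue `outerBlocks … n`.
[cite: KnuthTAOCP2, §4.6.4] -/
theorem midLoopFn_spec (row : List Bool) (acc : List (List Bool)) (n : ℕ) (hacc : n ≤ acc.length)
    (hn : n ≤ 2 * row.length + 2) :
    midLoopFn (boolPair (boolPair row (encodeNat n)) (boolPair (encodeNat n) (boolPair [] (body acc)))) =
      boolPair (boolPair row (encodeNat n)) (boolPair []
        (boolPair (List.replicate n true) (body (outerBlocks row acc n n)))) := by
  have hx : fstF (boolPair (boolPair row (encodeNat n)) (boolPair (encodeNat n) (boolPair [] (body acc)))) =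
      boolPair row (encodeNat n) := by simp [fstF]
  have hrounds : n ≤ X.eval (boolPair row (encodeNat n)).length := by rw [eval_X, length_boolPair]; omega
  rw [midLoopFn, hx, iterate_loopStep midBody _ n _ _ hrounds,
    loopModel_eq_iterate (g := midStep row (encodeNat n)) (fun cnt s => midBody_apply row _ cnt s),
    iterate_midStep row (encodeNat n) hacc rfl hn n]

/-! ### The closed form of the middle loop: `acc + row ⊗ row` -/

/-- The updated block `b`: `acc[b n + t] + row[b] · row[t]`, `t < n`, as strings. [folklore] -/
noncomputable def outerBlockNew (row : List Bool) (acc : List (List Bool)) (n b : ℕ) : List (List Bool) :=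
  List.ofFn fun t : Fin n => iaddFn (boolPair (acc.getD (b * n + t) []) (imulFn (boolPair (elemOf row b) (elemOf row t))))

/-- Length of an updated block. [folklore] -/
@[simp] theorem length_outerBlockNew (row : List Bool) (acc : List (List Bool)) (n b : ℕ) :
    (outerBlockNew row acc n b).length = n := by simp [outerBlockNew]

/-- The updated blocks `0, …, i-1`, concatenated. [folklore] -/
noncomputable def outerNewBlocks (row : List Bool) (acc : List (List Bool)) (n : ℕ) : ℕ → List (List Bool)
  | 0 => []
  | i + 1 => outerNewBlocks row acc n i ++ outerBlockNew row acc n i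

/-- Length of the concatenated updated blocks. [folklore] -/
@[simp] theorem length_outerNewBlocks (row : List Bool) (acc : List (List Bool)) (n : ℕ) :
    ∀ i, (outerNewBlocks row acc n i).length = i * n
  | 0 => by simp [outerNewBlocks]
  | i + 1 => by rw [outerNewBlocks, List.length_append, length_outerNewBlocks row acc n i, length_outerBlockNew]; ring

/-- The row loop's new block, computed on a queue whose front block is block `i` of `acc`, is the
updated block `i`. [folklore] -/
theorem rowNewsDP_front_eq (row : List Bool) (acc : List (List Bool)) (n i : ℕ) (hacc : acc.length = n * n) (hi : i < n)
    (F : List (List Bool)) :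
    rowNewsDP row (elemOf row i) 0 (acc.drop (i * n) ++ F) n = outerBlockNew row acc n i := by
  have hin : i * n + n ≤ n * n := by
    have := Nat.mul_le_mul_right n hi; rwa [Nat.succ_mul] at this
  unfold rowNewsDP outerBlockNew
  refine congrArg List.ofFn (funext fun t => ?_)
  have ht : (t : ℕ) < (acc.drop (i * n)).length := by rw [List.length_drop, hacc]; omega
  have hread : (acc.drop (i * n) ++ F).getD t [] = acc.getD (i * n + t) [] := by
    rw [List.getD_append _ _ _ _ ht, List.getD_eq_getElem?_getD, List.getElem?_drop, ← List.getD_eq_getElem?_getD]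
  rw [Nat.zero_add, hread]

/-- **Closed form of the middle loop's queue**: after `i ≤ n` rounds on a queue of `n²` entries,
`outerBlocks i = acc.drop (i n) ++ (updated blocks 0, …, i-1)`. [folklore] -/
theorem outerBlocks_eq (row : List Bool) (acc : List (List Bool)) (n : ℕ) (hacc : acc.length = n * n) :
    ∀ i : ℕ, i ≤ n → outerBlocks row acc n i = acc.drop (i * n) ++ outerNewBlocks row acc n i
  | 0, _ => by simp [outerBlocks, outerNewBlocks]
  | i + 1, hi => by
    have hi' : i < n := hi
    have hin : i * n + n ≤ n * n := by
      have := Nat.mul_le_mul_right n hi; rwa [Nat.succ_mul] at this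
    have hdroplen : n ≤ (acc.drop (i * n)).length := by rw [List.length_drop, hacc]; omega
    rw [outerBlocks, outerBlocks_eq row acc n hacc i (by omega), outerNewBlocks,
      rowNewsDP_front_eq row acc n i hacc hi' _, List.drop_append_of_le_length hdroplen, List.drop_drop, List.append_assoc,
      show i * n + n = (i + 1) * n by ring]

/-- Uniform-block indexing into the concatenated updated blocks. [folklore] -/
theorem getD_outerNewBlocks (row : List Bool) (acc : List (List Bool)) (n : ℕ) :
    ∀ (i b k : ℕ), b < i → k < n → (outerNewBlocks row acc n i).getD (b * n + k) [] = (outerBlockNew row acc n b).getD k []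
  | 0, b, k, hb, _ => absurd hb (Nat.not_lt_zero _)
  | i + 1, b, k, hb, hk => by
    rw [outerNewBlocks]
    rcases Nat.lt_succ_iff_lt_or_eq.1 hb with hlt | rfl
    · have hbn : b * n + k < (outerNewBlocks row acc n i).length := by
        rw [length_outerNewBlocks]
        have := Nat.mul_le_mul_right n hlt; rw [Nat.succ_mul] at this; omega
      rw [List.getD_append _ _ _ _ hbn]
      exact getD_outerNewBlocks row acc n i b k hlt hk
    · rw [List.getD_append_right _ _ _ _ (by rw [length_outerNewBlocks]; exact Nat.le_add_right _ _)]
      simp [length_outerNewBlocks]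

/-- **Values after the middle loop**: entry `(i, k)` of the queue is `acc[i n + k] + row[i] · row[k]`.
[cite: KnuthTAOCP2, §4.6.4] -/
theorem ival_outerBlocks (row : List Bool) (acc : List (List Bool)) (n : ℕ) (hacc : acc.length = n * n)
    {i k : ℕ} (hi : i < n) (hk : k < n) :
    ival ((outerBlocks row acc n n).getD (i * n + k) []) =
      ival (acc.getD (i * n + k) []) + ival (elemOf row i) * ival (elemOf row k) := by
  rw [outerBlocks_eq row acc n hacc n le_rfl, List.drop_of_length_le (by rw [hacc]), List.nil_append,
    getD_outerNewBlocks row acc n n i k hi hk, outerBlockNew, List.getD_eq_getElem _ _ (by simpa using hk), List.getElem_ofFn]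
  simp

/-! ### Outer level: all rows, each padded by the ruler `u` -/

/-- The record of the outer loop is `⟨⟨rows, ⟨nc, u⟩⟩, ⟨cnt, ⟨ju, q⟩⟩⟩`; the record handed to the
middle loop is `⟨⟨rows[|ju|] ++ u, nc⟩, ⟨nc, ⟨1⁰, q⟩⟩⟩`. [cite: KnuthTAOCP2, §4.6.4] -/
noncomputable def outSetupFn : List Bool → List Bool :=
  fanoutFn (fanoutFn (appendFn ∘ fanoutFn (elemFn ∘ fanoutFn (nthF 2) (fstF ∘ nthF 0)) (sndPow 1 ∘ nthF 0)) (nthF 1 ∘ nthF 0))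
    (fanoutFn (nthF 1 ∘ nthF 0) (fanoutFn (fun _ => []) (sndPow 2)))

/-- `outSetupFn ∈ FP`. [cite: AroraBarakCC2009, §1.3] -/
theorem outSetupFn_mem_FP : outSetupFn ∈ FP :=
  fanoutFn_mem_FP
    (fanoutFn_mem_FP (comp_mem_FP appendFn_mem_FP (fanoutFn_mem_FP
        (comp_mem_FP elemFn_mem_FP (fanoutFn_mem_FP (nthF_mem_FP 2) (comp_mem_FP fstF_mem_FP (nthF_mem_FP 0))))
        (comp_mem_FP (sndPow_mem_FP 1) (nthF_mem_FP 0))))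
      (comp_mem_FP (nthF_mem_FP 1) (nthF_mem_FP 0)))
    (fanoutFn_mem_FP (comp_mem_FP (nthF_mem_FP 1) (nthF_mem_FP 0)) (fanoutFn_mem_FP (const_mem_FP _) (sndPow_mem_FP 2)))

/-- **The outer round**: `⟨ju, q⟩ ↦ ⟨1 · ju, queue after the middle loop on the padded row `rows[|ju|] ++ u`⟩`.
[cite: KnuthTAOCP2, §4.6.4] -/
noncomputable def outBody : List Bool → List Bool :=
  fanoutFn (List.cons true ∘ nthF 2) (sndPow 2 ∘ midLoopFn ∘ outSetupFn)

/-- `outBody ∈ FP`. [cite: AroraBarakCC2009, §1.3] -/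
theorem outBody_mem_FP : outBody ∈ FP :=
  fanoutFn_mem_FP (comp_mem_FP (cons_mem_FP true) (nthF_mem_FP 2))
    (comp_mem_FP (sndPow_mem_FP 2) (comp_mem_FP midLoopFn_mem_FP outSetupFn_mem_FP))

/-- The state map of the outer loop. [folklore] -/
noncomputable def outStep (rows nc u : List Bool) (s : List Bool) : List Bool :=
  boolPair (true :: fstP s)
    (sndPow 2 (midLoopFn (boolPair (boolPair (elemOf rows (fstP s).length ++ u) nc) (boolPair nc (boolPair [] (sndP s))))))

/-- The outer round on a record is the state map. [folklore] -/
theorem outBody_apply (rows nc u cnt s : List Bool) :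
    outBody (boolPair (boolPair rows (boolPair nc u)) (boolPair cnt s)) = outStep rows nc u s := by
  have h1 : outSetupFn (boolPair (boolPair rows (boolPair nc u)) (boolPair cnt s)) =
      boolPair (boolPair (elemOf rows (fstP s).length ++ u) nc) (boolPair nc (boolPair [] (sndP s))) := by
    simp only [outSetupFn, fanoutFn_apply, Function.comp_apply, elemFn_boolPair, appendFn_boolPair]
    simp [nthF, sndPow, fstF, sndF, fstP, sndP]
  have h2 : nthF 2 (boolPair (boolPair rows (boolPair nc u)) (boolPair cnt s)) = fstP s := by simp [nthF, fstF, sndF, fstP]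
  unfold outBody outStep
  rw [fanoutFn_apply]
  rw [Function.comp_apply, Function.comp_apply, Function.comp_apply]
  rw [h2]
  rw [h1]

/-- The per-round growth polynomial of the middle loop step (loop overhead plus `length_midBody_le`).
[folklore] -/
noncomputable def midStepPoly : Polynomial ℕ := 4 * (X + 1) + (2 * X + 10 + 126 * (X + 1) * (3 * X + 3))

/-- Size of the middle loop's iterates from a general record. [folklore] -/
theorem length_iterate_loopStep_midBody_le (m : ℕ) (z : List Bool) :
    ((loopStep midBody)^[m] z).length ≤ z.length + m * midStepPoly.eval (fstF z).length :=
  length_iterate_le_of_growth_poly midStepPoly (fun w => fstF_loopStep midBody w)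
    (fun w => by
      change (loopStep midBody w).length ≤ w.length + midStepPoly.eval (fstF w).length
      simpa [midStepPoly] using length_loopStep_le_poly length_midBody_le w) z m

/-- The growth polynomial of an outer round. [folklore] -/
noncomputable def outBodyPoly : Polynomial ℕ := 2 * X + 10 + (3 * X + 2) * midStepPoly.comp (3 * X + 2)

/-- **Growth of an outer round is polynomial in the fixed field, on every record.** [folklore] -/
theorem length_outBody_le (z : List Bool) : (outBody z).length ≤ (sndPow 1 z).length + outBodyPoly.eval (fstF z).length := by
  have hju : nthF 2 z = fstF (sndPow 1 z) := by simp [nthF, sndPow, fstF, sndF]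
  have ht : sndPow 2 z = sndF (sndPow 1 z) := by simp [sndPow]
  have hst := length_fstF_sndF_le (sndPow 1 z)
  have hxsplit := length_fstF_sndF_le (fstF z)
  have hx2 := length_fstF_sndF_le (sndF (fstF z))
  have hrow : (elemOf (fstF (fstF z)) (fstF (sndPow 1 z)).length).length ≤ (fstF (fstF z)).length := length_elemOf_le _ _
  have hsetup : outSetupFn z = boolPair (boolPair (elemOf (fstF (fstF z)) (fstF (sndPow 1 z)).length ++ sndF (sndF (fstF z)))
      (fstF (sndF (fstF z)))) (boolPair (fstF (sndF (fstF z))) (boolPair [] (sndF (sndPow 1 z)))) := by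
    simp only [outSetupFn, fanoutFn_apply, Function.comp_apply, elemFn_boolPair, appendFn_boolPair, hju, ht]
    rfl
  set xmid := boolPair (elemOf (fstF (fstF z)) (fstF (sndPow 1 z)).length ++ sndF (sndF (fstF z))) (fstF (sndF (fstF z))) with hxmid
  set zmid := boolPair xmid (boolPair (fstF (sndF (fstF z))) (boolPair [] (sndF (sndPow 1 z)))) with hzmid
  have hxmidlen : xmid.length ≤ 3 * (fstF z).length + 2 := by
    rw [hxmid, length_boolPair, List.length_append]; omega
  have hzmidlen : zmid.length = 2 * xmid.length + 2 + (2 * (fstF (sndF (fstF z))).length + 2 + (2 * 0 + 2 + (sndF (sndPow 1 z)).length)) := by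
    simp only [hzmid, length_boolPair, List.length_nil]
  have hfz : fstF zmid = xmid := by simp [hzmid, fstF]
  have hmid : midLoopFn zmid = (loopStep midBody)^[xmid.length] zmid := by rw [midLoopFn, hfz, eval_X]
  have hrlen := length_iterate_loopStep_midBody_le xmid.length zmid
  rw [hfz] at hrlen
  have hrfst : fstF ((loopStep midBody)^[xmid.length] zmid) = xmid := by rw [fstF_iterate_loopStep, hfz]
  have hrstruct := length_sndPow_one_add_le ((loopStep midBody)^[xmid.length] zmid)
  rw [hrfst] at hrstruct
  have h2 := length_sndPow_two_le ((loopStep midBody)^[xmid.length] zmid)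
  have hbody : outBody z = boolPair (true :: fstF (sndPow 1 z)) (sndPow 2 ((loopStep midBody)^[xmid.length] zmid)) := by
    simp only [outBody, fanoutFn_apply, Function.comp_apply, hsetup, hmid, hju]
  rw [hbody, length_boolPair, List.length_cons]
  have key : (sndPow 2 ((loopStep midBody)^[xmid.length] zmid)).length ≤
      (sndF (sndPow 1 z)).length + 2 * (fstF (sndF (fstF z))).length + 6 + xmid.length * midStepPoly.eval xmid.length := by
    omega
  have hmono : xmid.length * midStepPoly.eval xmid.length ≤ (3 * (fstF z).length + 2) * midStepPoly.eval (3 * (fstF z).length + 2) :=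
    Nat.mul_le_mul hxmidlen (TM2Iter.eval_mono _ hxmidlen)
  have hev : outBodyPoly.eval (fstF z).length =
      2 * (fstF z).length + 10 + (3 * (fstF z).length + 2) * midStepPoly.eval (3 * (fstF z).length + 2) := by
    simp [outBodyPoly, Polynomial.eval_comp]
  rw [hev]
  omega

/-- **The outer loop** with round polynomial `p`: `p(|⟨rows, ⟨nc, u⟩⟩|)` rounds. [cite: KnuthTAOCP2, §4.6.4] -/
noncomputable def outLoopFn (p : Polynomial ℕ) (z : List Bool) : List Bool := (loopStep outBody)^[p.eval (fstF z).length] z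

/-- `outLoopFn p ∈ FP`. [cite: AroraBarakCC2009, §1.3] -/
theorem outLoopFn_mem_FP (p : Polynomial ℕ) : outLoopFn p ∈ FP :=
  loopFn_mem_FP_of_poly outBody_mem_FP outBodyPoly length_outBody_le p

/-- The accumulator after `J` rows: the zero `n × n` queue with the outer products of the padded rows
`rows[0] ++ u, …, rows[J-1] ++ u` added. [cite: KnuthTAOCP2, §4.6.4] -/
noncomputable def outerAcc (rows u : List Bool) (n : ℕ) : ℕ → List (List Bool)
  | 0 => List.replicate (n * n) []
  | j + 1 => outerBlocks (elemOf rows j ++ u) (outerAcc rows u n j) n n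

/-- The accumulator keeps `n²` entries. [folklore] -/
@[simp] theorem length_outerAcc (rows u : List Bool) (n : ℕ) : ∀ j, (outerAcc rows u n j).length = n * n
  | 0 => by simp [outerAcc]
  | j + 1 => by
    rw [outerAcc, length_outerBlocks _ (by rw [length_outerAcc rows u n j]; exact Nat.le_mul_self n), length_outerAcc rows u n j]

/-- The outer invariant. [folklore] -/
theorem iterate_outStep (rows u : List Bool) (n : ℕ) (hn : n ≤ 2 * u.length + 2) :
    ∀ j : ℕ, (outStep rows (encodeNat n) u)^[j] (boolPair [] (body (List.replicate (n * n) []))) =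
      boolPair (List.replicate j true) (body (outerAcc rows u n j))
  | 0 => rfl
  | j + 1 => by
    rw [Function.iterate_succ_apply', iterate_outStep rows u n hn j, outStep, fstP_boolPair, sndP_boolPair, List.length_replicate]
    have hacc : n ≤ (outerAcc rows u n j).length := by rw [length_outerAcc]; exact Nat.le_mul_self n
    have hrow : n ≤ 2 * (elemOf rows j ++ u).length + 2 := by rw [List.length_append]; omega
    rw [midLoopFn_spec (elemOf rows j ++ u) (outerAcc rows u n j) n hacc hrow]
    have hproj : ∀ A B C : List Bool, sndPow 2 (boolPair A (boolPair [] (boolPair B C))) = C := fun A B C => by simp [sndPow, sndF]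
    rw [hproj, List.replicate_succ]
    rfl

/-- **Specification of the outer loop**: from `⟨⟨rows, ⟨n, u⟩⟩, ⟨J, ⟨1⁰, body 0^{n²}⟩⟩⟩` with
`J ≤ p(|⟨rows, ⟨n, u⟩⟩|)` rounds available and a ruler with `n ≤ 2|u| + 2`, the loop ends with
index `1ᴶ` and the accumulated queue `outerAcc … J`. [cite: KnuthTAOCP2, §4.6.4] -/
theorem outLoopFn_spec (p : Polynomial ℕ) (rows u : List Bool) (n J : ℕ) (hn : n ≤ 2 * u.length + 2)
    (hJ : J ≤ p.eval (boolPair rows (boolPair (encodeNat n) u)).length) :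
    outLoopFn p (boolPair (boolPair rows (boolPair (encodeNat n) u))
        (boolPair (encodeNat J) (boolPair [] (body (List.replicate (n * n) []))))) =
      boolPair (boolPair rows (boolPair (encodeNat n) u)) (boolPair []
        (boolPair (List.replicate J true) (body (outerAcc rows u n J)))) := by
  have hx : fstF (boolPair (boolPair rows (boolPair (encodeNat n) u))
      (boolPair (encodeNat J) (boolPair [] (body (List.replicate (n * n) []))))) = boolPair rows (boolPair (encodeNat n) u) := by
    simp [fstF]
  rw [outLoopFn, hx, iterate_loopStep outBody _ J _ _ hJ,
    loopModel_eq_iterate (g := outStep rows (encodeNat n) u) (fun cnt s => outBody_apply rows _ u cnt s),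
    iterate_outStep rows u n hn J]

/-- **Values of the accumulated queue**: entry `(i, k)` after `J` rows is
`∑_{j<J} ival (rowⱼ[i]) · ival (rowⱼ[k])` with the padded rows `rowⱼ = rows[j] ++ u`.
[cite: KnuthTAOCP2, §4.6.4] -/
theorem ival_outerAcc (rows u : List Bool) (n : ℕ) {i k : ℕ} (hi : i < n) (hk : k < n) :
    ∀ J : ℕ, ival ((outerAcc rows u n J).getD (i * n + k) []) =
      ∑ j ∈ Finset.range J, ival (elemOf (elemOf rows j ++ u) i) * ival (elemOf (elemOf rows j ++ u) k)
  | 0 => by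
    have hlt : i * n + k < n * n := by
      have := Nat.mul_le_mul_right n hi; rw [Nat.succ_mul] at this; omega
    rw [outerAcc, List.getD_eq_getElem _ _ (by simpa using hlt)]
    simp
  | J + 1 => by
    rw [outerAcc, ival_outerBlocks _ _ _ (length_outerAcc rows u n J) hi hk, ival_outerAcc rows u n hi hk J, Finset.sum_range_succ]

end Brick

end Literature.Computability.Complexity
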